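import Mathlib
import HarnessLib
import HarnessLib.Audit
import Summits.AtomisticToContinuum.Statement
import Literature.MathematicalPhysics.StatisticalMechanics.BarlowStacking
import Summits.AtomisticToContinuum.Crystallization.Theorems.ExcessDecayLiouvilleCrysEnergyLimit
import HarnessLib.Audit.Status.Attr

/-!
Route: VdwKissingSutherland

# Route VdwKissingSutherland — vdW kissing inequality plus a deficit-stable Sutherland bound,
Lennard-Jones by the virial transfer

X = X_K ∧ X_S ∧ X_T ∧ X_R ∧ X_P ("it suffices to show"). X_K (VdwKissing, the card's "van der Waals
kissing problem"): around a
centre of a unit packing of ℝ³ the r⁻⁶-weighted TWO-SHELL sum Σ_{1≤|x|≤3/2}|x|⁻⁶ is at most 51/4 =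
12 + 6·(√2)⁻⁶, the common value
of every Barlow two-shell. X_S (SutherlandStable): "hcp maximises the van der Waals attraction among
all sphere packings" (the n = ∞
rung of the card's Mie (n,6) ladder = Sutherland's 1893 model) holds with LINEAR STABILITY in the
two-shell deficit: Σ_{i≠j} r_ij⁻⁶ +
(1/10)·Σ_i (51/4 − S_i) ≤ N·L₆(hcp). X_K makes every deficit non-negative, so X_K ∧ X_S give the
plain Sutherland bound Σ_{i≠j} r_ij⁻⁶ ≤
N·L₆(hcp) (glue item, provable now). X_T, X_R, X_P are the Lennard-Jones end SHARED verbatim with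
route HcpThetaUniversality: by the
virial identity LJ ground states, cleaned of ≤ N/1000 particles and rescaled by λ ∈ [1, 53/50], are
unit packings within 1/20 per
particle of L₆(hcp) (X_T); ground states that are 1/20-near-maximal r⁻⁶ packers crystallize
positionally (X_R); the periodic LJ
minimum is attained (X_P, item 0627). Realises card mie-ladder-vdw-kissing at its top rung
(conforming g2 successor of the retired
route MieLadderVdwKissing; the exponent descent is recorded, not filed — see Why this line / Not
decomposed yet).
Lean: `VdwKissing ∧ SutherlandStable ∧ LjGroundStatesNearInvSixMax ∧ NearMaxGroundStatesCrystallize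
∧ CrysPeriodicMinAttained`

## Assembly
The deciding theorem `closes` (folder glue.lean / Sketch.lean: sorry-free, axioms ⊆ {propext,
Classical.choice, Quot.sound}) does the
bookkeeping itself from the items: KissingStableGlue applied to VdwKissing and SutherlandStable
gives SutherlandBound, so S₆(y)/M ≤
L₆(hcp) for every finite unit packing y of M points (div_le_of_le_mul₀; M = 0 by L₆ ≥ 0,
tsum_nonneg); hence the conclusion of
LjGroundStatesNearInvSixMax (benchmark L₆(hcp) − 1/20) implies the hypothesis of
NearMaxGroundStatesCrystallize (benchmark S₆(y)/M −
1/20 for all y; filter_upwards + gcongr) → IsCrystallizing; CrysPeriodicMinAttained gives P with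
IsLeast, so ⨅_Q e(Q) = e(P)
(IsLeast.csInf_eq) and CrysEnergyLimit is the limit clause of HasPeriodicGroundStateEnergy; the pair
is `Crystallization`. Load-bearing:
VdwKissing, SutherlandStable, KissingStableGlue, LjGroundStatesNearInvSixMax,
NearMaxGroundStatesCrystallize, CrysPeriodicMinAttained,
CrysEnergyLimit; the hypotheses SutherlandBound and Assembly are not used. The `Assembly` item
restates this chain and is provable now.

Rationale: WHY THIS LINE. The card's ladder has a sound top rung and a broken bottom: hard spheres with the
full −r⁻⁶ tail (Sutherland1893) reduce, by
dilation-optimality of two-term Mie potentials, to ONE extremal problem of packing type — maximise Σ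
r⁻⁶ over unit packings — whose local
form is a weighted spherical-code inequality in the thick shell [1, 3/2] attackable by three-point /
multi-radius SDP (BachocVallentin2007,
DelaatDeoliveirafilhoVallentin2014, Laat2016) on top of Hales's η = 0 geometry (Hales2012:
twelve-contact packings are Barlow;
KusnerKusnerLagariasShlosman2018 for the 12-sphere configuration space); but the descent in the
repulsive exponent cannot reach n = 12
(V_n(0.9565) < 0 until n ≈ 57, a stretched Tammes-13 shell beats twelve contacts at one-centre level
for n ≤ 18 — numbers of the
g1 route), which is why route MieLadderVdwKissing was retired not-a-thesis under D-0027. This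
successor keeps the rung's two new
inequalities (VdwKissing; SutherlandStable = the card's "transfer-corrected averaged version",
stated as a stability modulus) and reaches
Lennard-Jones instead through the exact virial identity E = −(1/24)Σ_{i≠j} r⁻⁶ at dilation-critical
configurations (BlancLewin2015 §1,
Doye2000), i.e. through the LJ-transfer and rigidity-endgame items of route HcpThetaUniversality,
which it shares verbatim: the two routes
are ALTERNATIVE decompositions of the shared node SutherlandBound (stmt-3268) — there Θ-universality
of hcp among packings for every
Gaussian (CohnKumar2006-type, no local certificate), here the r⁻⁶-specific two-shell certificate
plus a deficit-stability inequality,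
which is also the "stability modulus of the r⁻⁶ packing problem" that HcpThetaUniversality names as
the unknown input of its endgame.
Imported areas: discrete geometry of packings (Hales2012, HopkinsStillingerTorquato2011 DLP data,
MusinTarasov2012), SDP bounds for
spherical codes of several radii, lattice-sum asymptotics (Stillinger2001, BurrowsEtAl2020,
KiharaKoba1952), the virial/scaling identity of
cluster physics. Negatives index: the two Crystallization entries (EffectiveLocalHales at tolerance
1/100, OneGrainGluing) concern soft
shells / grain gluing; VdwKissing lives at tolerance 0 (the decahedral shell needs 0.67 % strain and
is no unit-packing competitor) and
SutherlandStable is averaged.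

RANKED CRUXES. #2 VdwKissing (crux) — TWO-SHELL VAN DER WAALS KISSING INEQUALITY (card D1): for
every finite X ⊂ ℝ³ with 1 ≤ |x| ≤ 3/2 for all x ∈ X and pairwise distances ≥ 1 (the centres, within
3/2, of unit balls packed around a unit ball at 0), Σ_{x∈X} |x|⁻⁶ ≤ 51/4 = 12 + 6·(√2)⁻⁶, the value
of every Barlow two-shell (12 contacts, 6 octahedral caps at √2; the next Barlow distances √(8/3) =
1.633 and √3 exceed 3/2, so the inequality is stacking-blind by design). Expected proof: weighted
three-point / multi-radius SDP in the thick shell [1, 3/2] with the weight r⁻⁶, verified in interval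
arithmetic; the equality and first-order-rigidity cases (the 18-point fcc/hcp two-shells) are layer
2. [difficulty: L] (why it might fail: Deep holes pay: a 13th ball at 2cos θ behind a hole of
angular radius θ > 45° outweighs a √2 cap (1.2856 ↦ 0.221 vs 0.125); two 50° holes + three squares =
0.817 > 0.75 if realisable with 12 contacts; DLP: Z_max(R) > Z_Barlow(R) for all N ≥ 13; evidence is
crude multistart only.) [Hales2012, HopkinsStillingerTorquato2011,
DelaatDeoliveirafilhoVallentin2014, BachocVallentin2007, KusnerKusnerLagariasShlosman2018,
MusinTarasov2012]
#3 SutherlandStable (crux) — DEFICIT-STABLE SUTHERLAND BOUND (card D2, the averaged tail transfer,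
stated as a stability modulus): for every N-point unit packing x of ℝ³, Σ_i Σ_j |x_i − x_j|⁻⁶ +
(1/10)·Σ_i (51/4 − S_i) ≤ N·L₆(hcp), where S_i = Σ_{j≠i, |x_i−x_j|≤3/2} |x_i − x_j|⁻⁶ is the
two-shell sum of site i and L₆(hcp) = Σ_{y∈hcp∖0}|y|⁻⁶ = 14.45491 at nearest-neighbour distance 1
(Lean: the tsum over `hcpStacking 1 √(2/3)`, y = 0 and diagonal terms are 0⁻¹ = 0). Transfer
reading: with T_i the site sum beyond 3/2 and T_hcp = L₆(hcp) − 51/4 = 1.70491, the far-field excess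
Σ_i (T_i − T_hcp) is at most 9/10 of the total two-shell deficit Σ_i (51/4 − S_i) — "hcp maximises
the vdW attraction among packings" with linear stability in the deficit; exactly the modulus a
near-maximiser rigidity step (crux 5's foreseen child) consumes. [deps: VdwKissing] [difficulty: XL]
(why it might fail: Needs an averaged robust Fejes Tóth–Hales with a rate: packings with near-Barlow
two-shells but a denser far field (faulted/strained layers, Böröczky–Szabó quasi-12-neighbour
packings, tet–oct tilings) may push the excess/deficit ratio past 9/10 (bcc needs 0.008, an
icosahedral centre 0.43).) [Hales2012, BoroczkySzabo2016, Stillinger2001, BurrowsEtAl2020,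
ConwaySloane1999, doi:10.1007/bf02574051, HalesDSP2012]
#4 LjGroundStatesNearInvSixMax (crux) — LJ TRANSFER (shared verbatim with HcpThetaUniversality,
stmt-5058): for every sequence of Lennard-Jones ground states, eventually in N there are S ⊆ Fin N
with #(Fin N∖S) ≤ N/1000 and λ ∈ [1, 53/50] with λ·dist ≥ 1 on S and Σ_{i,j∈S} (λ·dist(x_i,x_j))⁻⁶ ≥
#S·(L₆(hcp) − 1/20). Expected proof: virial identity E = −S₆/24 + trial upper bound E(N) ≤ N·e(hcp)
+ C N^{2/3} (e(hcp) = −L₆²/(24 L₁₂), a* = (L₁₂/L₆)^{1/6} = 0.9712) +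
LennardJonesMinimalDistance_holds + a no-compression lemma + sum_inv_pow_six_le for the discarded
particles. [difficulty: XL] (why it might fail: Budget 6η·L₆ ≤ 0.048 forces compression tolerance η
≤ 5.5e-4 on all but N/1000 particles; persistent icosahedral cores (LJ₁₃ radial bonds ≈ 3 % short),
relaxed surfaces or strained grain boundaries at density > 1e-3 break it; print bounds only the
minimal distance.) [BlancLewin2015, Xue1997, Blanc2004, Stillinger2001, Doye2000, arXiv:1009.3003]
#5 NearMaxGroundStatesCrystallize (crux) — RIGIDITY ENDGAME (shared verbatim with
HcpThetaUniversality, stmt-5057): if for every sequence of Lennard-Jones ground states x^N,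
eventually in N, there are S ⊆ Fin N with #(Fin N∖S) ≤ N/1000 and λ ∈ [1, 53/50] such that λ·x^N|S
is a unit packing whose r⁻⁶ double sum is ≥ #S·(S₆(y)/M − 1/20) for EVERY finite unit packing y of M
points, then IsCrystallizing lennardJones 3. This route's cruxes 2–3 are designed to feed its first
step (near-maximal packers have small total two-shell deficit, hence Barlow two-shells off a small
fraction of sites). [deps: LjGroundStatesNearInvSixMax] [difficulty: open-problem] (why it might
fail: A 1/20 deficit is stacking-blind (fcc: 1e-3) and tolerates ≈0.3 % vacancies or 13-neighbour
sites; exact order must come from LJ minimality + stacking selection (J₂ ≈ −7e-5, uncertified): no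
self-improvement lemma in print; polytypic/aperiodic Barlow ground states refute it.)
[BlancLewin2015, Hales2012, BoroczkySzabo2016, KusnerKusnerLagariasShlosman2018,
PartayOrtnerCsanyi2017, FlatleyTheil2015]
#6 CrysPeriodicMinAttained (crux) — the infimum over periodic configurations of ℝ³ (full-rank
lattice + finite motif) of the Lennard-Jones energy per particle is attained (shared item 0627;
expected minimiser relaxed hcp). [difficulty: L] (why it might fail: False iff no periodic
configuration attains inf e_LJ: optimal stackings of growing period tending to an aperiodic Barlow
word, i.e. Hägg domination |J₂| > Σ_{k≥3} k|J_k| failing at the 1e-4 scale; print covers Bravais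
lattices only.) [BlancLewin2015, BeterminSamajTravenec2022, PartayOrtnerCsanyi2017, Stillinger2001]
#9 SutherlandBound (support) — SUTHERLAND RUNG, ENERGETIC (shared item stmt-3268, also wanted by
HcpThetaUniversality): for every N-point unit packing x of ℝ³, Σ_i Σ_j |x_i − x_j|⁻⁶ ≤ N·L₆(hcp)
("hcp maximises the van der Waals attraction among all sphere packings"). Here the corollary of
cruxes 2–3 through KissingStableGlue; the benchmark of cruxes 4–5. [difficulty: L] [Sutherland1893,
Stillinger2001, KiharaKoba1952, HopkinsStillingerTorquato2011]
#9 KissingStableGlue (support) — GLUE (finite sums; conclusion = SutherlandBound written out, so the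
item does not depend on rendering order): for each site i apply VdwKissing to the finset {x_j − x_i
: j ≠ i, |x_i − x_j| ≤ 3/2} (norms in [1, 3/2], pairwise ≥ 1 by the packing condition), so every
deficit 51/4 − S_i is ≥ 0; dropping (1/10)·Σ_i(51/4 − S_i) ≥ 0 from SutherlandStable gives
SutherlandBound. Makes crux 2 load-bearing in the deciding theorem. [difficulty: provable-now]
[BlancLewin2015, Hales2012]
#9 CrysEnergyLimit (support) — E(N)/N → ⨅ over periodic configurations of the LJ energy per particle
in d = 3 (shared item 0626; thermodynamic-limit bookkeeping: periodisation gives ⨅ ≤ E(N)/N for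
every N, trial blocks give limsup ≤ ⨅). [difficulty: M] [BlancLewin2015]

TWO-LAYER PLAN. Foreseen glued splits (k ≤ 3, depth 1; nothing filed now). VdwKissing ⇐
TwelveContactCase (X with twelve unit vectors: the holes of a
kissing arrangement — KusnerKusnerLagariasShlosman2018 configuration space; each non-square hole
deep enough to admit a ball inside 3/2
costs square holes) → ContactDeficitCase (≤ 11 contacts: each lost contact frees weight < 1 for
intruders in (1, 3/2]) → VdwKissing; or
directly a certified SDP dual (three-point, radii sampled in [1, 3/2], interval-verified) as ONE
child. SutherlandStable ⇐ TwoShellRigidity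
(stability of VdwKissing's equality case: 51/4 − S_i ≥ κ·min(η_i, η₀), η_i = matching distance of
site i's two-shell to a Barlow
two-shell; needs the 18-point patterns, Definition requests) → AveragedTailTransfer (Σ_i (T_i −
T_hcp) ≤ (9/10)κ·Σ_i min(η_i, η₀):
layer propagation off the defect set, Hales2012 + HalesDSP2012 layer packings, hcp site maximal
among Barlow sites by monotone pairing)
→ SutherlandStable. NearMaxGroundStatesCrystallize ⇐ PackingStabilityTwelve (from SutherlandStable +
TwoShellRigidity: a δ-near-maximal
unit packing has ≤ 10δN/κ sites with a non-Barlow two-shell — the stability modulus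
HcpThetaUniversality lists as unknown) →
LjSelfImprovement / BulkDefectVanish (shared 0751, with Hägg domination 0716/0737) →
DefectVanishCrystallizes (shared 0752).

KILL CRITERIA. VdwKissing refuted by an explicit configuration at cutoff 3/2 ⇒ repair once: the
repaired statement lowers the cutoff toward √2 + margin
(new decl, witness-avoiding); refuted even at cutoff 1.42 ⇒ pointwise two-shell certificates for r⁻⁶
are dead: close `superseded --by
route-AtomisticToContinuum-HcpThetaUniversality` (SutherlandBound keeps its other route).
SutherlandStable refuted by a packing with
excess/deficit ratio ρ ∈ (9/10, 1) ⇒ misstated: file the repaired modulus (1 − ρ)/2 as a new item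
and re-certify `closes`; ratio ≥ 1
(some unit packing with Σ_{i≠j} r⁻⁶ > N·L₆(hcp), e.g. a periodic non-Barlow packing beating 14.45491
per site) ⇒ SutherlandBound itself
is false, the Sutherland rung does not crystallize onto hcp and this line (and
HcpThetaUniversality's crux 2) is dead: close
`refuted:SutherlandStable` — news for every dispersion-tail card. LjGroundStatesNearInvSixMax
refuted (compressed cores at density >
1e-3 in large LJ ground states) ⇒ the virial transfer is too lossy for BOTH sibling routes: close
`superseded --by
route-AtomisticToContinuum-PRDenominatorTransfer` if open, else refuted.
NearMaxGroundStatesCrystallize dies only with IsCrystallizing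
itself; 0627 refuted ⇒ the conjunct is false as formalised (all routes). SutherlandBound PROVED
elsewhere (Θ-PACK + Bernstein) moots the
load-bearing role of cruxes 2–3 in `closes` but not their use as the stability input of crux 5: keep
the route open iff crux 5's split
has been filed through PackingStabilityTwelve, else close `superseded --by
route-AtomisticToContinuum-HcpThetaUniversality`.

NOT DECOMPOSED YET. Equality and first-order-rigidity cases of VdwKissing (the 18-point Barlow
two-shells; TwoShellRigidity) and the cutoff as a parameter;
the defect functional η_i and the averaged tail transfer (children of SutherlandStable); the
no-compression lemma and trial upper bound
(children of crux 4, owned jointly with HcpThetaUniversality); the self-improvement step of crux 5.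
Deliberately NOT filed although on the
card: the positional Sutherland rung (maximisers of Σ r⁻⁶ over N-point unit packings converge
locally to a periodic configuration; g1
item 3266) and the Mie (n,6) descent "∃ n₀ ∀ n ≥ n₀" (g1 item 3267) — under D-0027 neither bears on
`closes`, because no descent in the
exponent crosses the window [12, 57) (Numbers), and a non-load-bearing XL item only adds breakage;
both become corollary targets once
SutherlandStable + TwoShellRigidity stand (exact maximisers are then Barlow off O(N^{2/3}) sites).
Also not filed: the pointwise all-shell
bound VdwOneCentre (Σ_{|x|≥1}|x|⁻⁶ ≤ L₆(hcp) around any packing centre; g1 item 3265) — the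
alternative decomposition of SutherlandBound,
reserved as the `--resplit` fallback if SutherlandStable dies with ratio < 1 (note: its pointwise
TAIL half is false — an icosahedral
packing centre has tail 1.43 > 1.11 within radius 2 — so VdwKissing and VdwOneCentre never chain
pointwise; only the averaged form does).

CHEAPEST FALSIFIER. (1) Numerical global maximisation of Σ_{1≤|x|≤3/2}|x|⁻⁶ over ≤ 24 unit-separated
movable points with |x| ≥ 1 around a fixed centre
(basin hopping, minutes of kit time), seeded with the DLP optimal clusters N = 13…18 of
arXiv:1009.3003, widened-square and 50°-hole
deformations of the cuboctahedral / anticuboctahedral shells, icosahedral shell + intruders: any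
value > 12.75 kills VdwKissing at 3/2.
(2) Per-site evaluation of L₆(X) + (1/10)(51/4 − S_{3/2}(X)) against 14.45491 for periodic unit
packings X at minimal distance 1
(A15/σ/C14/C15, β-Mn, Böröczky–Szabó packings, tet–oct tilings, random close packings, LJ/sticky
inherent structures): one exceedance
kills SutherlandStable (L₆(X) alone above 14.45491 kills SutherlandBound and the sibling route too).
What I ran (calc/stable_check.py,
calc/dhcp_ico.py, plain python): slack of (2) = 0 (hcp), +0.00099 (fcc), +0.00002 / +0.00100 (dhcp
sites), +1.979 (bcc, ratio needed
0.008), +5.53 (sc); icosahedral packing centre S = 12 exactly, local excess/deficit ratio 0.43. The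
g1 planner's crude multistart for (1)
(13–22 free points) found nothing above 12.75; the widened-square move loses 2.25δ at first order.

NUMBERS. L₆(hcp) = 14.45491, L₆(fcc) = 14.45391, L₁₂(hcp) = 12.13229 at nearest-neighbour distance 1
(own sums; Stillinger2001; BurrowsEtAl2020);
hcp shells (r, count): (1,12), (√2,6), (√(8/3),2), (√3,18), (√(11/3),12), (2,6); fcc: (1,12),
(√2,6), (√3,24), (2,12); every Barlow
site has two-shell value 51/4 (adjacent layers contribute 3 at 1 and 3 at √2 each, whatever the
stacking) and T_hcp = 1.70491 ≥ T of any
Barlow site (dhcp c-site 1.70391 = fcc). Weights r⁻⁶: 1.0456 (Tammes-13 radius, MusinTarasov2012) ↦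
0.765; 2/√3 = 1.1547 ↦ 27/64;
1.2856 (ball behind a 50° hole) ↦ 0.221; 1.340 (behind a square widened to 1.05) ↦ 0.173; √2 ↦ 1/8;
3/2 ↦ 0.0878; 1.5893 (icosahedral
face cap) ↦ 0.0622. bcc at unit separation: S_{3/2} = 8 + 6·27/64 = 10.53125, L₆ = 12.25368, T =
1.72243 (> T_hcp: the pure far-field
transfer, modulus 1, is FALSE already for bcc — hence a modulus < 1); sc: S = 7.5, L₆ = 8.40193.
Icosahedral packing centre: 12 at 1
(shell edge 1.05146), 20 face caps at 1.58931, 12 at 2: two-shell value 12 exactly, tail 1.43 within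
radius 2 vs hcp 1.109.
Decahedral (D5h) contact shell (two eclipsed pentagonal rings ρ = √3/2, z = ±1/2, two poles; in-ring
distance 1.018): 12 contacts +
5 rectangle caps at 1.4013 (0.1321 each) = 12.660 < 51/4 — fewer square holes, lower score (own
check, this session). Widened square of side 1 + δ: cap gain
+0.75δ, four neighbouring caps recede ≥ 0.75δ each, net −2.25δ (g1 calc/widen.py). LJ end
(HcpThetaUniversality NUMBERS): a* =
(L₁₂/L₆)^{1/6} = 0.97123, e(hcp) = −L₆²/(24L₁₂) = −0.71759, e(fcc) = −0.71752; crux-4 budget 1/20 ⇔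
compression tolerance η ≤ 5.5e-4 on
all but N/1000 particles. Why the exponent descent is not filed: V_n(0.9565) = 0.9565⁻ⁿ/n −
0.9565⁻⁶/6 < 0 for n ≤ 56 (compressed
13-shells still bind), and 13·V_n(1.0456) < 12·V_n(1) iff n ≤ 18. Items at open: 9 (5 cruxes, 3
support, assembly).

DEFINITION REQUESTS. None at open: hcpStacking (BarlowStacking.lean), IsGroundState /
groundStateEnergy / lennardJones / PeriodicConfiguration /
IsCrystallizing (Crystallization.lean) exist and carry no unproved named fact. Foreseen (layer 2):
`fccTwoShell`, `hcpTwoShell : Finset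
(EuclideanSpace ℝ (Fin 3))` — the 18-point Barlow two-shells via `scaledPattern` (topic
Literature/Geometry/DiscreteGeometry,
KissingPatterns.lean) — for the equality case of VdwKissing and for TwoShellRigidity; a cite fact
for the Tammes N = 13 radius
(MusinTarasov2012) only if the twelve-contact split of VdwKissing is filed.

Novelty: Searches (2026-08-15, this session): `lit frontier AtomisticToContinuum --since 2020` (30 rows;
crystallization descendants arXiv:2407.20762,
arXiv:2604.19239 — planar / polycrystal, nothing on packing-constrained r⁻⁶ sums); `lit bridges
AtomisticToContinuum --cross any` (30 rows,
none on packings); `lit search --source crossref` × 7: "sphere packing lattice sums inverse power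
hexagonal close packed maximum" (8:
doi:10.1063/5.0021159 = BurrowsEtAl2020), "What are all the best sphere packings in low dimensions"
(doi:10.1007/bf02574051 Conway–Sloane
1995), "Lattice sums … phase diagram … Lennard-Jones" (doi:10.1063/1.1394922 = Stillinger2001),
"upper bounds for packings of spheres of
several radii semidefinite" (doi:10.1017/fms.2014.24), "strong thirteen spheres"
(doi:10.1007/s00454-011-9392-2), "sticky hard sphere …
van der Waals … ground state" (8, noise), "Sutherland potential hard sphere attractive tail ground
state hcp" (local searchd rc 75);
`lit search --source zbmath "energy minimization sphere packing inverse power law hexagonal close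
packing"` (0); openalex HTTP 429; arxiv 0;
`lit galaxy search --star all` × 5 ("Sutherland potential" 15 rows — Calogero–Sutherland /
unrelated; "van der Waals kissing",
"attractive hard spheres ground state", "lattice sums for the hexagonal close", one long phrase: 0
each); plus the audited searches on the
card (R4, refuter-12: Sutherland 1893, Kihara–Koba, Stillinger, DLP arXiv:1009.3003 p. 6 read) and
on the same-day routes
MieLadderVd  [refs: 10.1063/5.0021159, 10.1007/bf02574051, 10.1063/1.1394922, 10.1017/fms.2014.24, 10.1007/s00454-011-9392-2, 2407.20762, 2604.19239, 1009.3003, 2107.11380, doi:10.1063/5.0021159, doi:10.1007/bf02574051, doi:10.1063/1.1394922, doi:10.1017/fms.2014.24, doi:10.1007/s00454-011-9392-2, BurrowsEtAl2020, Stillinger2001, KiharaKoba1952, HopkinsStillingerTorquato2011, Hales2012, DelaatDeoliveirafilhoVallentin]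

Barriers (technique_class: vdw-packing-extremal, sdp-certificate, virial-reduction): - technique_class: vdw-packing-extremal, sdp-certificate, virial-reduction
- Literature.Barriers.AtomisticToContinuum.LocalizedPotentialsExcludeLennardJones: APPLIES to
perturbation-from-a-brittle-model lines and killed the card's descent as a route spine; evaded here
by not perturbing at all — the packing rung enters Lennard-Jones through the exact virial identity
at n = 12 (crux 4), whose no-compression budget η ≤ 5.5e-4 is where LJ softness is honestly paid.
- Literature.Barriers.AtomisticToContinuum.KissingTwelveDegeneracy: APPLIES to contact counting
(twelve contacts never select the stacking); evaded because the functional is the full r⁻⁶ sum: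
VdwKissing is deliberately stacking-blind (fcc = hcp = 51/4), selection enters through the far field
(hcp site maximal among Barlow sites by monotone pairing of the aligned-minus-staggered layer sums)
and inside crux 5 (Hägg domination 0716/0737).
- Literature.Barriers.AtomisticToContinuum.ShortRangeStackingBlindness: respected, not met — the
cutoff 3/2 < √(8/3) certificate is asked only for the stacking-independent value 51/4; nothing of
range < √(8/3) selects.
- Literature.Barriers.AtomisticToContinuum.FlexibleKissingArrangements: APPLIES to single-shell
inference (the 12-sphere configuration space is connected, icosahedral ↔ cuboctahedral); priced, not
assumed away: the r⁻⁶ weight on the SECOND shell rewards square holes (octahedral caps at √2), the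
contact-free icosahedral shell scores 12 < 51/4, and the bet of crux 2 is exact

Novelty grade: new-combination — ROUTE REVIEW rreview-0815T18-23 (full text: evidence VDW_route_review.md on this route). STATE rev 0, not in tree; needs_repair glue.extra-hypothesis x2: CrysPeriodicMinAttained 0627 + CrysEnergyLimit 0626 NOT attached; fix: route edit --add-items by signature (HcpThetaUniversality has both). ELAB:  (refuter refuter-rreview-0815T18-23-0, 2026-08-15T19:39:19Z; prior: Sutherland1893 (Phil. Mag. (5)36:507; hard core + r^-6 tail, hcp ground state unproved), Hales2012 arXiv:1209.6043 (twelve-contact packings Barlow), arXiv:1009.3003 HopkinsStillingerTorquato DLP II (pointwise count version), Stillinger2001 doi:10.1063/1.1394922, KiharaKoba1952 (L6 hcp > fcc), DelaatDeoliveirafilhoVallentin2014 doi:10.1017/fms.2014.24 (multi-radius SDP), route-AtomisticToContinuum-)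

History (route lifecycle, newest last):
- 2026-08-24T05:18:36Z · DORMANT — reconciler: no traction for 6.6 d (last activity statement-attached at 2026-08-17T15:13:09Z); parked, not closed — `ledger route dormant route-AtomisticToContin (operator:999:3265596)
- 2026-08-31T09:31:05Z · REACTIVATED (open) — reconciler: reactivated — activity statement-checked at 2026-08-31T08:36:26Z after parking at 2026-08-24T05:18:36Z (operator:999:2734709)

sub-problem: Crystallization · status: open · opened planner-plancard-AtomisticToContinuum-Crystal-82f0e224-g2-0 2026-08-15T18:51:41Z · rev 2 · ledger route-AtomisticToContinuum-VdwKissingSutherland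
GENERATED by the gate from the ledger (D-0016/17). Provers cite these decls: `theorem foo : Summit.AtomisticToContinuum.Crystallization.Theses.VdwKissingSutherland.<Decl> := …` in Summits/AtomisticToContinuum/Crystallization/Theorems/<Name>.lean.
-/

namespace Summit.AtomisticToContinuum.Crystallization.Theses.VdwKissingSutherland

open scoped BigOperators Topology Manifold Classical MeasureTheory ProbabilityTheory Matrix InnerProductSpace ComplexConjugate ContinuousMap
open Filter Set Function TopologicalSpace MeasureTheory

attribute [summit_statement] _root_.Crystallization

/-- item stmt-AtomisticToContinuum-12230 · crux · rank 2 · open · by planner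
why it might fail: Deep holes pay: a 13th ball at 2cos θ behind a hole of angular radius θ > 45° outweighs a √2 cap (1.2856 ↦ 0.221 vs 0.125); two 50° holes + three squares = 0.817 > 0.75 if realisable with 12 contacts; DLP: Z_max(R) > Z_Barlow(R) for all N ≥ 13; evidence is crude multistart only.
sources: Hales2012, HopkinsStillingerTorquato2011, DelaatDeoliveirafilhoVallentin2014, BachocVallentin2007, KusnerKusnerLagariasShlosman2018, MusinTarasov2012
[crux] TWO-SHELL VAN DER WAALS KISSING INEQUALITY (card D1): for every finite X ⊂ ℝ³ with 1 ≤ |x| ≤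
3/2 for all x ∈ X and pairwise distances ≥ 1 (the centres, within 3/2, of unit balls packed around a
unit ball at 0), Σ_{x∈X} |x|⁻⁶ ≤ 51/4 = 12 + 6·(√2)⁻⁶, the value of every Barlow two-shell (12
contacts, 6 octahedral caps at √2; the next Barlow distances √(8/3) = 1.633 and √3 exceed 3/2, so
the inequality is stacking-blind by design). Expected proof: weighted three-point / multi-radius SDP
in the thick shell [1, 3/2] with the weight r⁻⁶, verified in interval arithmetic; the equality and
first-order-rigidity cases (the 18-point fcc/hcp two-shells) are layer 2. [difficulty: L] -/
@[route_item "route-AtomisticToContinuum-VdwKissingSutherland", crux]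
def VdwKissing : Prop :=
  ∀ X : Finset (EuclideanSpace ℝ (Fin 3)), (∀ x ∈ X, 1 ≤ ‖x‖ ∧ ‖x‖ ≤ 3 / 2) → (∀ x ∈ X, ∀ y ∈ X, x ≠ y → 1 ≤ dist x y) → ∑ x ∈ X, ‖x‖⁻¹ ^ 6 ≤ 51 / 4

/-- item stmt-AtomisticToContinuum-12231 · crux · rank 3 · open · by planner
why it might fail: Needs an averaged robust Fejes Tóth–Hales with a rate: packings with near-Barlow two-shells but a denser far field (faulted/strained layers, Böröczky–Szabó quasi-12-neighbour packings, tet–oct tilings) may push the excess/deficit ratio past 9/10 (bcc needs 0.008, an icosahedral centre 0.43).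
sources: Hales2012, BoroczkySzabo2016, Stillinger2001, BurrowsEtAl2020, ConwaySloane1999, doi:10.1007/bf02574051
[crux] DEFICIT-STABLE SUTHERLAND BOUND (card D2, the averaged tail transfer, stated as a stability
modulus): for every N-point unit packing x of ℝ³, Σ_i Σ_j |x_i − x_j|⁻⁶ + (1/10)·Σ_i (51/4 − S_i) ≤
N·L₆(hcp), where S_i = Σ_{j≠i, |x_i−x_j|≤3/2} |x_i − x_j|⁻⁶ is the two-shell sum of site i and
L₆(hcp) = Σ_{y∈hcp∖0}|y|⁻⁶ = 14.45491 at nearest-neighbour distance 1 (Lean: the tsum over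
`hcpStacking 1 √(2/3)`, y = 0 and diagonal terms are 0⁻¹ = 0). Transfer reading: with T_i the site
sum beyond 3/2 and T_hcp = L₆(hcp) − 51/4 = 1.70491, the far-field excess Σ_i (T_i − T_hcp) is at
most 9/10 of the total two-shell deficit Σ_i (51/4 − S_i) — "hcp maximises the vdW attraction among
packings" with linear stability in the deficit; exactly the modulus a near-maximiser rigidity step
(crux 5's foreseen child) consumes. [deps: VdwKissing] [difficulty: XL] -/
@[route_item "route-AtomisticToContinuum-VdwKissingSutherland", crux]
def SutherlandStable : Prop :=
  ∀ (N : ℕ) (x : Fin N → EuclideanSpace ℝ (Fin 3)), (∀ i j, i ≠ j → 1 ≤ dist (x i) (x j)) → ∑ i, ∑ j, (dist (x i) (x j))⁻¹ ^ 6 + (1 / 10) * ∑ i, (51 / 4 - ∑ j ∈ Finset.univ.filter (fun j => j ≠ i ∧ dist (x i) (x j) ≤ 3 / 2), (dist (x i) (x j))⁻¹ ^ 6) ≤ (N : ℝ) * ∑' y : ↥(Literature.MathematicalPhysics.StatisticalMechanics.hcpStacking 1 (Real.sqrt (2 / 3))), ‖(y : EuclideanSpace ℝ (Fin 3))‖⁻¹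 ^ 6

/-- item stmt-AtomisticToContinuum-5058 · crux · rank 4 · open · by planner
why it might fail: Budget 6η·L₆ ≤ 0.048 forces compression tolerance η ≤ 5.5e-4 on all but N/1000 particles; persistent icosahedral cores (LJ₁₃ radial bonds ≈ 3 % short), relaxed surfaces or strained grain boundaries at density > 1e-3 break it; print bounds only the minimal distance.
sources: BlancLewin2015, Xue1997, Blanc2004, Stillinger2001, Doye2000, arXiv:1009.3003
[crux] LJ TRANSFER (card N5 "no-compression" + virial, made quantitative): for every sequence of LJ
ground states, eventually in N there are S ⊆ Fin N, #(Fin N∖S) ≤ N/1000, and λ ∈ [1, 53/50] with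
λ·dist ≥ 1 on S and Σ_{i,j∈S} (λ·dist(x_i,x_j))⁻⁶ ≥ #S·(L₆(hcp) − 1/20), L₆(hcp) = Σ_{y∈hcp} |y|⁻⁶ =
14.4549 at nearest-neighbour distance 1. Expected proof: virial E = −S₆/24 (LjVirialInvSix) + trial
upper bound E(N) ≤ N·e(hcp) + C N^{2/3} (e(hcp) = −L₆²/(24 L₁₂), scale a* = (L₁₂/L₆)^{1/6} = 0.9712)
+ LennardJonesMinimalDistance_holds + a NO-COMPRESSION lemma (bonds shorter than (1−η)a*, η ≈ 5e-4,
at o(N) particles) + sum_inv_pow_six_le for the discarded particles. [difficulty: XL] -/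
@[route_item "route-AtomisticToContinuum-VdwKissingSutherland", crux]
def LjGroundStatesNearInvSixMax : Prop :=
  ∀ x : (N : ℕ) → (Fin N → EuclideanSpace ℝ (Fin 3)), (∀ N, Literature.MathematicalPhysics.StatisticalMechanics.IsGroundState Literature.MathematicalPhysics.StatisticalMechanics.lennardJones (x N)) → ∀ᶠ N in Filter.atTop, ∃ (S : Finset (Fin N)) (c : ℝ), 1000 * ((N : ℝ) - S.card) ≤ N ∧ 1 ≤ c ∧ c ≤ 53 / 50 ∧ (∀ i ∈ S, ∀ j ∈ S, i ≠ j → 1 ≤ c * dist (x N i) (x N j)) ∧ (S.card : ℝ) * ((∑' y : ↥(Literature.MathematicalPhysics.StatisticalMechanics.hcpStacking 1 (Real.sqrt (2 / 3))), ‖(y : EuclideanSpace ℝ (Fin 3))‖⁻¹ ^ 6) - 1 / 20) ≤ ∑ i ∈ S, ∑ j ∈ S, (c * dist (x N i) (x N j))⁻¹ ^ 6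

/-- item stmt-AtomisticToContinuum-5057 · crux · rank 5 · open · by planner
why it might fail: A 1/20 deficit is stacking-blind (fcc: 1e-3) and tolerates ≈0.3 % vacancies or 13-neighbour sites; exact order must come from LJ minimality + stacking selection (J₂ ≈ −7e-5, uncertified): no self-improvement lemma in print; polytypic/aperiodic Barlow ground states refute it.
sources: BlancLewin2015, Hales2012, BoroczkySzabo2016, KusnerKusnerLagariasShlosman2018, PartayOrtnerCsanyi2017, FlatleyTheil2015
[crux] RIGIDITY ENDGAME (card N5 "stability form" + the perturbative endgame, positional half): if
for every sequence of Lennard-Jones ground states x^N, eventually in N, there are S ⊆ Fin N with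
#(Fin N∖S) ≤ N/1000 and λ ∈ [1, 53/50] such that λ·x^N|S is a unit packing whose r⁻⁶ double sum is ≥
#S·(S₆(y)/M − 1/20) for EVERY finite unit packing y of M points (i.e. within 1/20 per particle of
the packing supremum), then IsCrystallizing lennardJones 3 (Blanc–Lewin (15)–(17)). [deps:
HcpThetaMaxPackings] [difficulty: open-problem] -/
@[route_item "route-AtomisticToContinuum-VdwKissingSutherland", crux]
def NearMaxGroundStatesCrystallize : Prop :=
  (∀ x : (N : ℕ) → (Fin N → EuclideanSpace ℝ (Fin 3)), (∀ N, Literature.MathematicalPhysics.StatisticalMechanics.IsGroundState Literature.MathematicalPhysics.StatisticalMechanics.lennardJones (x N)) → ∀ᶠ N in Filter.atTop, ∃ (S : Finset (Fin N)) (c : ℝ), 1000 * ((N : ℝ) - S.card) ≤ N ∧ 1 ≤ c ∧ c ≤ 53 / 50 ∧ (∀ i ∈ S, ∀ j ∈ S, i ≠ j → 1 ≤ c * dist (x N i) (x N j)) ∧ ∀ (M : ℕ) (y : Fin M → EuclideanSpace ℝ (Fin 3)), (∀ i j, i ≠ j → 1 ≤ dist (y i) (y j)) → (S.card : ℝ)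 * ((∑ i, ∑ j, (dist (y i) (y j))⁻¹ ^ 6) / M - 1 / 20) ≤ ∑ i ∈ S, ∑ j ∈ S, (c * dist (x N i) (x N j))⁻¹ ^ 6) → Literature.MathematicalPhysics.StatisticalMechanics.IsCrystallizing Literature.MathematicalPhysics.StatisticalMechanics.lennardJones 3

/-- item stmt-AtomisticToContinuum-0627 · crux · rank 6 · open · by planner
why it might fail: False iff no periodic configuration attains inf e_LJ: optimal stackings of growing period tending to an aperiodic Barlow word, i.e. Hägg domination |J₂| > Σ_{k≥3} k|J_k| failing at the 1e-4 scale; print covers Bravais lattices only.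
sources: BlancLewin2015, BeterminSamajTravenec2022, PartayOrtnerCsanyi2017, Stillinger2001
The infimum over periodic configurations of ℝ³ of the Lennard-Jones energy per particle is attained
(by some lattice G and finite motif F). Needs stacking selection (c) + compactness of near-optimal
periodic configurations at bounded density / bounded-below distances; refuted if optimal LJ
stackings are aperiodic with unattained infimum (route RefuteCrystalPeriodicMin). -/
@[route_item "route-AtomisticToContinuum-VdwKissingSutherland", crux]
def CrysPeriodicMinAttained : Prop :=
  ∃ P : Literature.MathematicalPhysics.StatisticalMechanics.PeriodicConfiguration 3, IsLeast (Set.range fun Q : Literature.MathematicalPhysics.StatisticalMechanics.PeriodicConfiguration 3 => Q.energyPerParticle Literature.MathematicalPhysics.StatisticalMechanics.lennardJones) (P.energyPerParticle Literature.MathematicalPhysics.StatisticalMechanics.lennardJones)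

/-- item stmt-AtomisticToContinuum-0626 · support · rank 9 · closed · proved by Summit.AtomisticToContinuum.Crystallization.Theorems.crysEnergyLimit_proof @ f456c3bab3f9 (prover) · by planner
sources: BlancLewin2015
Energetic crystallization: E(N)/N converges to the infimum over periodic (multi-lattice)
configurations of the LJ energy per particle in d = 3. Lower bound liminf ≥ ⨅ is the content ((a)
local optimality + (d) + surface term O(N^{2/3})); upper bound is filed separately. -/
@[route_item "route-AtomisticToContinuum-VdwKissingSutherland", crux]
def CrysEnergyLimit : Prop :=
  Filter.Tendsto (fun N : ℕ => Literature.MathematicalPhysics.StatisticalMechanics.groundStateEnergy Literature.MathematicalPhysics.StatisticalMechanics.lennardJones 3 N / N) Filter.atTop (nhds (⨅ Q : Literature.MathematicalPhysics.StatisticalMechanics.PeriodicConfiguration 3, Q.energyPerParticle Literature.MathematicalPhysics.StatisticalMechanics.lennardJones))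

/-- `CrysEnergyLimit` holds: proved by `Summit.AtomisticToContinuum.Crystallization.Theorems.crysEnergyLimit_proof` @ f456c3bab3f9. -/
theorem CrysEnergyLimit_holds : CrysEnergyLimit := _root_.Summit.AtomisticToContinuum.Crystallization.Theorems.crysEnergyLimit_proof

/-- item stmt-AtomisticToContinuum-12232 · support · rank 9 · closed · proved by Summit.AtomisticToContinuum.Crystallization.Theorems.kissingStableGlue_proof @ 4a5e4427826e (prover) · by planner
sources: BlancLewin2015, Hales2012
[support] GLUE (finite sums; conclusion = SutherlandBound written out, so the item does not depend
on rendering order): for each site i apply VdwKissing to the finset {x_j − x_i : j ≠ i, |x_i − x_j|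
≤ 3/2} (norms in [1, 3/2], pairwise ≥ 1 by the packing condition), so every deficit 51/4 − S_i is ≥
0; dropping (1/10)·Σ_i(51/4 − S_i) ≥ 0 from SutherlandStable gives SutherlandBound. Makes crux 2
load-bearing in the deciding theorem. [difficulty: provable-now] -/
@[route_item "route-AtomisticToContinuum-VdwKissingSutherland", crux]
def KissingStableGlue : Prop :=
  VdwKissing → SutherlandStable → ∀ (N : ℕ) (x : Fin N → EuclideanSpace ℝ (Fin 3)), (∀ i j, i ≠ j → 1 ≤ dist (x i) (x j)) → ∑ i, ∑ j, (dist (x i) (x j))⁻¹ ^ 6 ≤ (N : ℝ) * ∑' y : ↥(Literature.MathematicalPhysics.StatisticalMechanics.hcpStacking 1 (Real.sqrt (2 / 3))), ‖(y : EuclideanSpace ℝ (Fin 3))‖⁻¹ ^ 6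

-- `KissingStableGlue` holds: proved by `Summit.AtomisticToContinuum.Crystallization.Theorems.kissingStableGlue_proof` @ 4a5e4427826e (its module imports this route file, so no `_holds` link can be stated here).

/-- item stmt-AtomisticToContinuum-3268 · support · rank 9 · open · by planner
sources: Sutherland1893, Stillinger2001, KiharaKoba1952, HopkinsStillingerTorquato2011
[support] SUTHERLAND RUNG, ENERGETIC ("hcp maximises the van der Waals attraction among all sphere
packings"): for every N and every N-point unit packing x of ℝ³, Σ_i Σ_{j≠i} |x_i − x_j|⁻⁶ ≤ N ·
L₆(hcp) (diagonal terms are 0⁻¹ = 0 in Lean). Corollary of VdwOneCentre by summing over centres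
(filed because it is the energetic top-rung statement other dispersion-tail cards want —
theta-universality-packings at its r⁻⁶ slice, adhesive-spheres-weak-cm-tail — and because it becomes
THE crux, to be proved by the two-shell deficit of VdwKissing plus an averaged tail transfer (card
D2), if the pointwise VdwOneCentre dies). With the hcp ball as trial packing it gives sup_N
(1/N)·max S₆ = L₆(hcp) and, via hcpPeriodicConfiguration, the periodic maximum is attained.
[difficulty: M] -/
@[route_item "route-AtomisticToContinuum-VdwKissingSutherland", crux]
def SutherlandBound : Prop :=
  ∀ (N : ℕ) (x : Fin N → EuclideanSpace ℝ (Fin 3)), (∀ i j, i ≠ j → 1 ≤ dist (x i) (x j)) → ∑ i, ∑ j, (dist (x i) (x j))⁻¹ ^ 6 ≤ (N : ℝ) * ∑' y : ↥(Literature.MathematicalPhysics.StatisticalMechanics.hcpStacking 1 (Real.sqrt (2 / 3))), ‖(y : EuclideanSpace ℝ (Fin 3))‖⁻¹ ^ 6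

/-- item stmt-AtomisticToContinuum-12233 · assembly · rank 1 · closed · proved by Summit.AtomisticToContinuum.Crystallization.Theorems.vdwKissingSutherland_assembly_proof @ f593d99468fd (prover) · by planner
sources: BlancLewin2015, Sutherland1893
[assembly] VdwKissing → SutherlandStable → KissingStableGlue → LjGroundStatesNearInvSixMax →
NearMaxGroundStatesCrystallize → CrysPeriodicMinAttained → CrysEnergyLimit → Crystallization (the
body of `closes`; provable now by the same lines). -/
@[route_item "route-AtomisticToContinuum-VdwKissingSutherland", crux]
def Assembly : Prop :=
  VdwKissing → SutherlandStable → KissingStableGlue → LjGroundStatesNearInvSixMax → NearMaxGroundStatesCrystallize → CrysPeriodicMinAttained → CrysEnergyLimit → Crystallization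

-- `Assembly` holds: proved by `Summit.AtomisticToContinuum.Crystallization.Theorems.vdwKissingSutherland_assembly_proof` @ f593d99468fd (its module imports this route file, so no `_holds` link can be stated here).

/-! D-0027 §2.1 — DECIDING THEOREM (planner-authored via `route open/edit --closes-file`; by planner-rbadge-AtomisticToContinuum-VdwKissing-2144ee70-0 2026-08-15T19:25:37Z):
its hypotheses are this route's items and its conclusion the sub-problem Statement (glue_lint), and it elaborates with this file. -/

@[closes "route-AtomisticToContinuum-VdwKissingSutherland"] theorem closes : VdwKissing → SutherlandStable → LjGroundStatesNearInvSixMax → NearMaxGroundStatesCrystallize →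
    CrysPeriodicMinAttained → SutherlandBound → KissingStableGlue → CrysEnergyLimit → Assembly →
    _root_.Crystallization := by
  intro h_VdwKissing h_SutherlandStable h_LjGroundStatesNearInvSixMax h_NearMaxGroundStatesCrystallize
    h_CrysPeriodicMinAttained _h_SutherlandBound h_KissingStableGlue h_CrysEnergyLimit _h_Assembly
  -- Direct bookkeeping from the items (neither the hypothesis `SutherlandBound` nor `Assembly` is used).
  -- (1) packing engine: the two-shell inequality (crux 2) makes every two-shell deficit non-negative, so the
  --     deficit-stable Sutherland bound (crux 3) yields the plain r⁻⁶ packing bound through the glue item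
  have hS : SutherlandBound := h_KissingStableGlue h_VdwKissing h_SutherlandStable
  -- the hcp benchmark L₆ = Σ_{y ∈ hcp} ‖y‖⁻⁶ is non-negative (covers the empty competitor M = 0, where S₆(y)/M = 0/0 = 0)
  have hL : (0 : ℝ) ≤ ∑' y : ↥(Literature.MathematicalPhysics.StatisticalMechanics.hcpStacking 1 (Real.sqrt (2 / 3))),
      ‖(y : EuclideanSpace ℝ (Fin 3))‖⁻¹ ^ 6 :=
    tsum_nonneg fun y => by positivity
  -- (2) positional half: LJ ground states are 1/20-near the hcp benchmark after cleaning/rescaling (crux 4); by the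
  --     Sutherland bound the hcp benchmark dominates S₆(y)/M for every finite unit packing y of M points, so they are
  --     1/20-near the packing supremum — the hypothesis of the rigidity endgame (crux 5)
  have hpos : Literature.MathematicalPhysics.StatisticalMechanics.IsCrystallizing
      Literature.MathematicalPhysics.StatisticalMechanics.lennardJones 3 := by
    apply h_NearMaxGroundStatesCrystallize
    intro x hx
    filter_upwards [h_LjGroundStatesNearInvSixMax x hx] with N hN
    obtain ⟨S, c, hcard, hc1, hc2, hpack, hsum⟩ := hN
    refine ⟨S, c, hcard, hc1, hc2, hpack, ?_⟩
    intro M y hy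
    have hy' := hS M y hy
    have hdiv : (∑ i, ∑ j, (dist (y i) (y j))⁻¹ ^ 6) / (M : ℝ) ≤
        ∑' z : ↥(Literature.MathematicalPhysics.StatisticalMechanics.hcpStacking 1 (Real.sqrt (2 / 3))),
          ‖(z : EuclideanSpace ℝ (Fin 3))‖⁻¹ ^ 6 :=
      div_le_of_le_mul₀ (Nat.cast_nonneg M) hL (by rw [mul_comm]; exact hy')
    calc (S.card : ℝ) * ((∑ i, ∑ j, (dist (y i) (y j))⁻¹ ^ 6) / M - 1 / 20)
        ≤ (S.card : ℝ) * ((∑' z : ↥(Literature.MathematicalPhysics.StatisticalMechanics.hcpStacking 1 (Real.sqrt (2 / 3))),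
            ‖(z : EuclideanSpace ℝ (Fin 3))‖⁻¹ ^ 6) - 1 / 20) := by
          gcongr
      _ ≤ ∑ i ∈ S, ∑ j ∈ S, (c * dist (x N i) (x N j))⁻¹ ^ 6 := hsum
  -- (3) energetic half: the periodic minimum is attained at some P (crux 6), so ⨅_Q e(Q) = e(P) (IsLeast.csInf_eq),
  --     and the bookkeeping limit E(N)/N → ⨅_Q e(Q) (support 0626) is the limit clause of HasPeriodicGroundStateEnergy
  obtain ⟨P, hP⟩ := h_CrysPeriodicMinAttained
  have hinf : (⨅ Q : Literature.MathematicalPhysics.StatisticalMechanics.PeriodicConfiguration 3,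
      Q.energyPerParticle Literature.MathematicalPhysics.StatisticalMechanics.lennardJones) =
      P.energyPerParticle Literature.MathematicalPhysics.StatisticalMechanics.lennardJones :=
    hP.csInf_eq
  have hlim : Filter.Tendsto
      (fun N : ℕ => Literature.MathematicalPhysics.StatisticalMechanics.groundStateEnergy
        Literature.MathematicalPhysics.StatisticalMechanics.lennardJones 3 N / N) Filter.atTop
      (nhds (P.energyPerParticle Literature.MathematicalPhysics.StatisticalMechanics.lennardJones)) := by
    have h0 : CrysEnergyLimit := h_CrysEnergyLimit
    unfold CrysEnergyLimit at h0
    rw [hinf] at h0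
    exact h0
  -- Crystallization = HasPeriodicGroundStateEnergy lennardJones 3 ∧ IsCrystallizing lennardJones 3
  exact ⟨⟨P, hP, hlim⟩, hpos⟩

end Summit.AtomisticToContinuum.Crystallization.Theses.VdwKissingSutherland
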